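import Mathlib
import HarnessLib
import Literature.Geometry.Lorentzian.KerrTimeDerivative
import Literature.Geometry.Lorentzian.KerrSchildWaveCauchyProblem

/-!
# Route ZeroEnergyKerrOrBomb · item `KerrModeStability` — restriction of functions on a
# horizon-penetrating Kerr–Schild chart to the exterior chart

Helper file for item stmt-FinalStateConjecture-10024 (`KerrModeStability`). The item and the
Cauchy-problem fact `Kerr.exists_wave_of_data` produce functions on a horizon-penetrating chart
`Kerr.region a r₀ = {r > r₀}`, `r₀ ≤ r₊`, while the wave-energy vocabulary of gr.S24
(`sliceEnergy`, `graphSliceEnergy`, `kerr_far_TEnergy_comparison_of_farRadius_le`,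
`kerr_far_finite_speed_of_propagation`, …) speaks of functions on the exterior chart
`Kerr.exterior M a = Kerr.region a r₊ = {r > r₊}`. This file records the (definition-free)
restriction `ψ' = fun y : Kerr.exterior M a ↦ ψ ⟨y, _⟩` and its bookkeeping:

* `kerr_restrict_rep` — the extension by zero of `ψ` from the big chart represents `ψ'`;
* `kerr_restrict_contMDiff` — `ψ'` is smooth if `ψ` is;
* `kerr_extend_restrict_eventuallyEq`, `kerr_fderiv_extend_restrict`,
  `kerr_coordEnergyDensity_restrict` — near exterior points the two extensions by zero agree, so
  do their differentials and coordinate energy densities;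
* `kerr_mfderiv_restrict` — `dψ' = dψ` at exterior points;
* `kerr_dalembertian_restrict` — `□_{g} ψ' = □_{g} ψ` at exterior points (both are the
  divergence-form coordinate expression `∑_μ ∂_μ(g^{μν} ∂_ν ψ̃)` of `Kerr.dalembertian_eq_divergence`
  in the common representative).

No new definitions.
-/

noncomputable section

namespace Summit.FinalStateConjecture.FinalStateConjecture.Theorems

open Literature.Geometry.Lorentzian Set Filter
open scoped Manifold ContDiff Topology

-- every `Summit.FinalStateConjecture.FinalStateConjecture.…` name repeats the summit = sub-problem segment (D-0017 layout)
set_option linter.dupNamespace false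

/-- The extension by zero of `ψ : Kerr.region a r₀ → ℝ` represents the restriction of `ψ` to the
exterior chart (`r₀ ≤ r₊`). -/
theorem kerr_restrict_rep {M a r₀ : ℝ} (hr : r₀ ≤ Kerr.rPlus M a) (ψ : Kerr.region a r₀ → ℝ)
    (y : Kerr.exterior M a) :
    (fun y : Kerr.exterior M a ↦ ψ ⟨(y : E4), Kerr.region_mono a hr y.2⟩) y =
      Function.extend Subtype.val ψ 0 y :=
  extend_rep ψ ⟨(y : E4), Kerr.region_mono a hr y.2⟩

/-- **The restriction of a smooth function to the exterior chart is smooth.** -/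
theorem kerr_restrict_contMDiff {M a r₀ : ℝ} (hr : r₀ ≤ Kerr.rPlus M a)
    {ψ : Kerr.region a r₀ → ℝ} {n : ℕ∞ω} (hψ : ContMDiff 𝓘(ℝ, E4) 𝓘(ℝ, ℝ) n ψ) :
    ContMDiff 𝓘(ℝ, E4) 𝓘(ℝ, ℝ) n
      (fun y : Kerr.exterior M a ↦ ψ ⟨(y : E4), Kerr.region_mono a hr y.2⟩) := fun y ↦
  (OpensChart.contMDiffAt_iff y _ _ (kerr_restrict_rep hr ψ)).mpr
    (contDiffAt_extend hψ ⟨(y : E4), Kerr.region_mono a hr y.2⟩)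

/-- Near an exterior point, the extension by zero of the restriction agrees with the extension by
zero of the original function (both are the function itself on the open exterior). -/
theorem kerr_extend_restrict_eventuallyEq {M a r₀ : ℝ} (hr : r₀ ≤ Kerr.rPlus M a)
    (ψ : Kerr.region a r₀ → ℝ) {z : E4} (hz : z ∈ Kerr.exterior M a) :
    Function.extend Subtype.val
        (fun y : Kerr.exterior M a ↦ ψ ⟨(y : E4), Kerr.region_mono a hr y.2⟩) 0 =ᶠ[𝓝 z]
      Function.extend Subtype.val ψ 0 := by
  filter_upwards [(Kerr.exterior M a).isOpen.mem_nhds hz] with w hw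
  have h1 := (extend_rep (fun y : Kerr.exterior M a ↦ ψ ⟨(y : E4), Kerr.region_mono a hr y.2⟩)
    ⟨w, hw⟩).symm
  rw [h1]
  exact kerr_restrict_rep hr ψ ⟨w, hw⟩

/-- At an exterior point the two extensions by zero take the same value. -/
theorem kerr_extend_restrict_apply {M a r₀ : ℝ} (hr : r₀ ≤ Kerr.rPlus M a)
    (ψ : Kerr.region a r₀ → ℝ) {z : E4} (hz : z ∈ Kerr.exterior M a) :
    Function.extend Subtype.val
        (fun y : Kerr.exterior M a ↦ ψ ⟨(y : E4), Kerr.region_mono a hr y.2⟩) 0 z =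
      Function.extend Subtype.val ψ 0 z :=
  (kerr_extend_restrict_eventuallyEq hr ψ hz).eq_of_nhds

/-- At an exterior point the two extensions by zero have the same differential. -/
theorem kerr_fderiv_extend_restrict {M a r₀ : ℝ} (hr : r₀ ≤ Kerr.rPlus M a)
    (ψ : Kerr.region a r₀ → ℝ) {z : E4} (hz : z ∈ Kerr.exterior M a) :
    fderiv ℝ (Function.extend Subtype.val
        (fun y : Kerr.exterior M a ↦ ψ ⟨(y : E4), Kerr.region_mono a hr y.2⟩) 0) z =
      fderiv ℝ (Function.extend Subtype.val ψ 0) z :=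
  (kerr_extend_restrict_eventuallyEq hr ψ hz).fderiv_eq

/-- **At exterior points the coordinate energy densities of `ψ` and of its restriction agree**
(`coordEnergyDensity` is built from the differential of the extension by zero). -/
theorem kerr_coordEnergyDensity_restrict {M a r₀ : ℝ} (hr : r₀ ≤ Kerr.rPlus M a)
    (ψ : Kerr.region a r₀ → ℝ) {z : E4} (hz : z ∈ Kerr.exterior M a) :
    coordEnergyDensity (Kerr.exterior M a)
        (fun y : Kerr.exterior M a ↦ ψ ⟨(y : E4), Kerr.region_mono a hr y.2⟩) z =
      coordEnergyDensity (Kerr.region a r₀) ψ z := by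
  simp only [coordEnergyDensity, kerr_fderiv_extend_restrict hr ψ hz]

/-- **At exterior points the manifold differentials of `ψ` and of its restriction agree** (both are
the Fréchet differential of the common representative, `OpensChart.mfderiv_eq`). -/
theorem kerr_mfderiv_restrict {M a r₀ : ℝ} (hr : r₀ ≤ Kerr.rPlus M a)
    {ψ : Kerr.region a r₀ → ℝ} {n : ℕ∞ω} (hn : n ≠ 0) (hψ : ContMDiff 𝓘(ℝ, E4) 𝓘(ℝ, ℝ) n ψ)
    (y : Kerr.exterior M a) :
    mfderiv 𝓘(ℝ, E4) 𝓘(ℝ, ℝ)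
        (fun y : Kerr.exterior M a ↦ ψ ⟨(y : E4), Kerr.region_mono a hr y.2⟩) y =
      mfderiv 𝓘(ℝ, E4) 𝓘(ℝ, ℝ) ψ ⟨(y : E4), Kerr.region_mono a hr y.2⟩ := by
  have hΦ : DifferentiableAt ℝ (Function.extend Subtype.val ψ 0) y :=
    (contDiffAt_extend hψ ⟨(y : E4), Kerr.region_mono a hr y.2⟩).differentiableAt hn
  rw [OpensChart.mfderiv_eq y _ _ (kerr_restrict_rep hr ψ) hΦ,
    OpensChart.mfderiv_eq (⟨(y : E4), Kerr.region_mono a hr y.2⟩ : Kerr.region a r₀) ψ _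
      (extend_rep ψ) hΦ]

/-- **The wave operator commutes with restriction to the exterior chart**: for `ψ` smooth on
`Kerr.region a r₀`, `r₀ ≤ r₊`, and an exterior point `y`, `□_{g_{M,a}} ψ'(y) = □_{g_{M,a}} ψ(y)`,
where `ψ'` is the restriction and the two d'Alembertians are those of `Kerr.smoothMetric M a r₊`
and `Kerr.smoothMetric M a r₀` (the same Kerr–Schild bilinear form on the two chart domains): both
equal `∑_μ ∂_μ (∑_ν g^{μν} ∂_ν ψ̃)(y)` in the common representative `ψ̃`
(`Kerr.dalembertian_eq_divergence`). Kerr–Schild 1965, §2. -/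
theorem kerr_dalembertian_restrict [Kerr.Facts] [Kerr.SliceFacts] {M a r₀ : ℝ}
    (hr : r₀ ≤ Kerr.rPlus M a) {ψ : Kerr.region a r₀ → ℝ}
    (hψ : ContMDiff 𝓘(ℝ, E4) 𝓘(ℝ, ℝ) ∞ ψ) (y : Kerr.exterior M a) :
    (Kerr.smoothMetric M a (Kerr.rPlus M a)).toPseudoRiemannianMetric.dalembertian
        (fun y : Kerr.exterior M a ↦ ψ ⟨(y : E4), Kerr.region_mono a hr y.2⟩) y =
      (Kerr.smoothMetric M a r₀).toPseudoRiemannianMetric.dalembertian ψ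
        ⟨(y : E4), Kerr.region_mono a hr y.2⟩ := by
  have hΦ2 : ContDiffAt ℝ 2 (Function.extend Subtype.val ψ 0) y :=
    (contDiffAt_extend hψ ⟨(y : E4), Kerr.region_mono a hr y.2⟩).of_le
      (WithTop.coe_le_coe.mpr le_top)
  rw [Kerr.dalembertian_eq_divergence M a (Kerr.rPlus M a) (kerr_restrict_rep hr ψ) y hΦ2,
    Kerr.dalembertian_eq_divergence M a r₀ (extend_rep ψ)
      (⟨(y : E4), Kerr.region_mono a hr y.2⟩ : Kerr.region a r₀) hΦ2]

/-- **A solution on the big chart restricts to a solution on the exterior chart**: if `□_g ψ = 0`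
at all points of `Kerr.region a r₀` with `r > r₊` (subextremal parameters, `r₀ ≤ r₊`), then the
restriction solves `□_g ψ' = 0` everywhere on `Kerr.exterior M a`. -/
theorem kerr_dalembertian_restrict_eq_zero [Kerr.Facts] [Kerr.SliceFacts] {M a r₀ : ℝ}
    (hMa : Kerr.IsSubextremal M a) (hr : r₀ ≤ Kerr.rPlus M a) {ψ : Kerr.region a r₀ → ℝ}
    (hψ : ContMDiff 𝓘(ℝ, E4) 𝓘(ℝ, ℝ) ∞ ψ)
    (hsol : ∀ x : Kerr.region a r₀, Kerr.rPlus M a < Kerr.radius a (x : E4) →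
      (Kerr.smoothMetric M a r₀).toPseudoRiemannianMetric.dalembertian ψ x = 0)
    (y : Kerr.exterior M a) :
    (Kerr.smoothMetric M a (Kerr.rPlus M a)).toPseudoRiemannianMetric.dalembertian
        (fun y : Kerr.exterior M a ↦ ψ ⟨(y : E4), Kerr.region_mono a hr y.2⟩) y = 0 := by
  rw [kerr_dalembertian_restrict hr hψ y]
  refine hsol _ ?_
  have := Kerr.mem_exterior.mp y.2
  rwa [max_eq_left hMa.rPlus_pos.le] at this

end Summit.FinalStateConjecture.FinalStateConjecture.Theorems

end
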